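import Summits.ResolutionOfSingularities.ResolutionOfSingularities.Theorems.WeightedInvariantLocalWeightedDropNCGameDecoratedWinsFinite
import Summits.ResolutionOfSingularities.ResolutionOfSingularities.Theorems.WeightedInvariantLocalWeightedDropNCResSettingStart

/-!
# TOT2-LINE, piece S-END in DECORATED form: the endgame `o ≤ 1` from the bare finite-win rung (binder `hR8`)

Crux item stmt-ResolutionOfSingularities-8899 `WeightedInvariant.LocalWeightedDrop` (route `ResolutionOfSingularities/WeightedInvariant`), ENGINE
skeleton v32, residual `stub_spaceNCRankDrop`, TOT2-LINE v1/v1.1 (res-L1-w43-lead-1), settings layer S-SET (res-L1-w43-stub-1: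
`Decoration`, `Admissible`, `sqfRep`, …).  [OURS · L1 W4.3 · seat res-D-pv-006 (S-END); def-free; NOT a statement of any manuscript.]

THE DECORATED STATES of TOT2-LINE are the admissibly decorated positions `⟨(b, δ), Admissible b δ⟩` with germ `b` (every non-zero germ
carries one: `admissible_start`, S-SET `…NCResSettingStart`).
* `ne_zero_of_admissible` — admissibly decorated germs are non-zero;
* `dWinsTo_of_winsIn_admissible` — a finite-round win of the germ is a decorated win towards the target (by `DWinsTo.of_winsIn`, p530487);
* `winsIn_of_admissible_of_o_le_one`, **`dWinsTo_end_of_rung`** — THE ENDGAME IN DECORATED FORM from the BARE RUNG R8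
  `hR8 : ∀ f, f.order = 1 → ∀ E, ∃ n, WinsIn GermIsNC n (f · ∏_{l∈E} X l)` (res-L1-w43-strat-1 CRITIQUE-TOT2-v1 §1; being kernelled as
  `tot_rung_r8`): every admissible decorated state with `o ≤ 1` wins towards «germ is `GermIsNC`» — `o = 0` is (T0) `germIsNC_of_admissible_of_o_eq_zero`
  (S-SET); at `o = 1` radical transport (`winsIn_of_dvd_pow` with `germIsNC_of_dvd_pow`) carries the R8 win of the total equation to the position.
  Instantiate `hR8` with the tree constant once R8 lands.
-/

set_option linter.dupNamespace false -- mandated namespace of this single-conjunct summit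

namespace Summit.ResolutionOfSingularities.ResolutionOfSingularities.Theorems

namespace TameFourTupleDrop

open MvPowerSeries Literature.AlgebraicGeometry.Resolution

variable {k : Type} [Field k] {m : ℕ}

/-! ## Admissibly decorated germs -/

/-- An admissibly decorated germ is non-zero (its reduced total equation, a multiple of the squarefree `f ≠ 0`… divides a power of it). -/
theorem ne_zero_of_admissible {b : MvPowerSeries (Fin (m + 1)) k} {δ : Decoration k m} (h : Admissible b δ) : b ≠ 0 := by
  obtain ⟨⟨M, N, hdvd, -⟩, hsq, -⟩ := h
  intro hb
  rw [hb, zero_dvd_iff] at hdvd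
  have htot : δ.total = 0 := (pow_eq_zero_iff (Nat.succ_ne_zero M)).mp hdvd
  have hf : δ.f ≠ 0 := hsq.ne_zero
  apply hf
  have hprod : (∏ l ∈ δ.E, (X l : MvPowerSeries (Fin (m + 1)) k)) ≠ 0 :=
    Finset.prod_ne_zero_iff.mpr fun l _ => (MvPowerSeries.prime_X' k l).ne_zero
  exact (mul_eq_zero.mp htot).resolve_right hprod

/-! ## Finite-round wins of admissibly decorated germs are decorated wins -/

/-- For the state type of admissibly decorated positions: a finite-round win of the germ is a decorated win towards `P ∘ germ`. -/
theorem dWinsTo_of_winsIn_admissible {P : MvPowerSeries (Fin (m + 1)) k → Prop}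
    {σ : {p : MvPowerSeries (Fin (m + 1)) k × Decoration k m // Admissible p.1 p.2}} {n : ℕ} (hσ : WinsIn P n σ.1.1) :
    DWinsTo (fun τ : {p : MvPowerSeries (Fin (m + 1)) k × Decoration k m // Admissible p.1 p.2} => τ.1.1) (fun τ => P τ.1.1) σ :=
  DWinsTo.of_winsIn (germ := fun τ : {p : MvPowerSeries (Fin (m + 1)) k × Decoration k m // Admissible p.1 p.2} => τ.1.1)
    (fun τ => ne_zero_of_admissible τ.2) (fun b hb => ⟨⟨(b, Decoration.start (sqfRep b)), admissible_start hb⟩, rfl⟩) hσ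

/-! ## The endgame `o ≤ 1` from the bare rung -/

/-- **THE ENDGAME FROM THE BARE RUNG, in rounds**: given R8 (`hR8`), every admissibly decorated germ with `o ≤ 1` is won within finitely many
rounds. -/
theorem winsIn_of_admissible_of_o_le_one
    (hR8 : ∀ f : MvPowerSeries (Fin (m + 1)) k, f.order = 1 → ∀ E : Finset (Fin (m + 1)),
      ∃ n, WinsIn (m := m) GermIsNC n (f * ∏ l ∈ E, X l))
    {b : MvPowerSeries (Fin (m + 1)) k} {δ : Decoration k m} (hadm : Admissible b δ) (ho : δ.o ≤ 1) :
    ∃ n, WinsIn (m := m) GermIsNC n b := by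
  rcases Nat.eq_zero_or_pos δ.o with h0 | hpos
  · -- (T0): the position itself is already a normal crossing
    exact ⟨0, (winsIn_zero _ _).mpr (germIsNC_of_admissible_of_o_eq_zero hadm h0)⟩
  · -- `o = 1`: the total equation is won within finitely many rounds by R8; radical transport carries the win to `b`
    obtain ⟨⟨M, N, hbM, -⟩, hsq, -⟩ := hadm
    have hf : δ.f ≠ 0 := hsq.ne_zero
    have htot0 : δ.total ≠ 0 :=
      mul_ne_zero hf (Finset.prod_ne_zero_iff.mpr fun l _ => (MvPowerSeries.prime_X' k l).ne_zero)
    have horder : δ.f.order = 1 := by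
      have hne : δ.f.order ≠ ⊤ := fun h => hf (order_eq_top_iff.mp h)
      have h := ENat.coe_toNat hne
      rw [show (δ.f.order).toNat = 1 from le_antisymm ho hpos] at h
      exact h.symm
    obtain ⟨n, hn⟩ := hR8 δ.f horder δ.E
    exact ⟨n, winsIn_of_dvd_pow (fun N b d hd hnc hbd => germIsNC_of_dvd_pow N b d hd hnc hbd) n M b δ.total htot0 hn hbM⟩

/-- **S-END IN DECORATED FORM (from the bare rung R8)**: on the state type of admissibly decorated positions, every state whose strict
transform has order `≤ 1` wins towards «the germ is a normal crossing». -/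
theorem dWinsTo_end_of_rung
    (hR8 : ∀ f : MvPowerSeries (Fin (m + 1)) k, f.order = 1 → ∀ E : Finset (Fin (m + 1)),
      ∃ n, WinsIn (m := m) GermIsNC n (f * ∏ l ∈ E, X l))
    (σ : {p : MvPowerSeries (Fin (m + 1)) k × Decoration k m // Admissible p.1 p.2}) (ho : σ.1.2.o ≤ 1) :
    DWinsTo (fun τ : {p : MvPowerSeries (Fin (m + 1)) k × Decoration k m // Admissible p.1 p.2} => τ.1.1)
      (fun τ => GermIsNC τ.1.1) σ := by
  obtain ⟨n, hn⟩ := winsIn_of_admissible_of_o_le_one hR8 σ.2 ho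
  exact dWinsTo_of_winsIn_admissible hn

end TameFourTupleDrop

end Summit.ResolutionOfSingularities.ResolutionOfSingularities.Theorems
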